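import Summits.BirchSwinnertonDyer.BirchSwinnertonDyer.Theorems.AlignedTransportAtTwoMainConjectureOfRankZeroBSDAtTwoCubicDepthDoorGenusCert
import Literature.NumberTheory.IwasawaTheory.ClassicalMuVanishesLayerTwoCapitulationTwo
import HarnessLib

/-!
# Route `AlignedTransportAtTwo`, crux C2 `MainConjectureOfRankZeroBSDAtTwo` (stmt-BirchSwinnertonDyer-22298):
# THE CAPITULATION DOOR INTO `MC₂(W)` — on the hard core (`Δ_min ≡ 5 (mod 8)`, `h(ℚ(β))` odd, `ord₂ h(ℚ(β,√2)) = 1`): if the class of order two of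
# `Cl(ℚ(β,√2))` (att-p3 g43's odd genus certificate `𝔔 = (x + y√2, α)`) becomes PRINCIPAL in `ℚ(β)·ℚ(ζ₁₆)⁺`, then `μ₂ = 0`, `λ₂ ≤ 2` for the cubic field and `MC₂(W)`

HONEST FRAMING (cell `bsd-f1-sign2`, WIDTH-5 attached prover seat `bsd-line-att-p3` gen 45 on line `birth` of the lead `bsd-line-att-p2`;
`--supports` stmt-BirchSwinnertonDyer-22298, closes nothing; BSD is NOT proved by any of this; the crux C2, its verdict «blocked-on
`Rank1Residual.GreenbergMuConjectureIrreducible`» and every registered stub are untouched).  THEOREMS ONLY — no definition, no named fact, no `sorry`.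
The `W`-level packaging of this seat's Literature door `IwasawaTheory/ClassicalMuVanishesLayerTwoCapitulationTwo` (genus theory for `K_2/K_1` when the
`2`-part of `Cl(K_1)` capitulates: `rank₂ Cl(K_2) ≤ ord₂ h(K_1) + #{v ∣ 2} − 1 = 2`, then att-p3 g40's `(0,2)` rank-jump door), companion of att-p3 g44's
`…CubicLayerTwoUnitDoorFlex` (same layer, unit certificate) and att-p3 g43's `…CubicDepthDoorGenusCert` (the odd genus certificate).

WHY.  On the hard core of the off-stratum sub-cell (`t = 3`, genus regime (β), `e₁ = 1`; seeds `N = 1259, 3027, 3523, 9139, 14891, …`) the layer-2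
trichotomy of this seat's memo `Cruxes/…/LAYER-TWO-TRICHOTOMY-att-p3-g45.md` says that EXACTLY ONE of `𝔔𝓞_{K_2}` (capitulation), `𝔓₂^{(2)}𝔔` (aligned),
`𝔓₂^{(2)}` (dead at layer 2) is principal.  The first case is THIS door; its certificate is ONE generator `ξ ∈ ℤ[β'][θ]` of `𝔔𝓞_{K_2}` with cofactors —
twelve-coordinate data in `𝓞_{ℚ(β)}` and three polynomial identities —, NO unit and NO class group of the degree-12 field.

* **`classicalMuVanishes_adjoin_of_genusCert_odd_of_capitulationCert`** — `W` globally minimal, good ordinary at `2`, no rational `2`-torsion abscissa,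
  `Δ_min ≡ 5 (mod 8)`, `Δ_W < 0`, `β` a root of the `2`-division cubic; displayed: `h(ℚ(β))` odd, `2 ∤ d_{ℚ(β)}`, `𝔭₁` of norm `2`, a unit `ε ≡ ±1 (mod 𝔭₁³)`
  with `±ε` non-squares, the odd genus certificate `x, y, α, m, n, m', n', u`, and the capitulation certificate `ξ, a, b, c, e` ⟹ for every cyclotomic
  `ℤ₂`-extension of `ℚ(β)`: `rank₂ Cl(K_m) = rank₂ Cl(K_2) ≤ 2` (`m ≥ 2`), `μ₂ = 0`, `λ₂ ≤ 2`.
* **`mazurMainConjecture_two_of_muIneqRel_of_genusCert_odd_of_capitulationCert`** — PRINT⁵ + MuIneqʳ (registered stub verbatim) + the cell hypotheses + the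
  same data ⟹ `MC₂(W)` (att-p5 g24's cubic carrier road).

CONDITIONAL theorems (PRINT⁵, MuIneqʳ displayed); nothing is asserted about any curve; no seed of the current census is in the capitulation case
(`N = 9139` is in the aligned case: `…CubicLayerTwoRowN9139`); nothing is closed; BSD is not proved.

References: [Gras2003] IV.4; [Greenberg1976] §4; [Fukuda1994] Thm. 1; [Washington1997] §13.3 Prop. 13.22–13.23; [Serre1973CourseArithmetic] Ch. III §1.2
Thm. 1; [Kato2004Asterisque] Thm. 17.4 (1)(2) (p. 273); [GreenbergLNM1716] Thm. 4.1 (p. 102), Conj. 1.11 (p. 58); tree: this seat's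
`IwasawaTheory/ClassicalMuVanishesLayerTwoCapitulationTwo`, `NumberFields/QuadraticGenusTwoRankExact` §4, att-p3 g43 `…CubicDepthDoorGenusCert`, att-p5 g24
`…CubicCarrierRoad`.
-/

set_option linter.dupNamespace false
set_option autoImplicit false

noncomputable section

open scoped Classical NumberField nonZeroDivisors

namespace Summit.BirchSwinnertonDyer.BirchSwinnertonDyer.Theorems.AlignedTransportAtTwoCubicCapitulationDoor

open NumberField IsDedekindDomain Polynomial WeierstrassCurve IntermediateField CongruenceSubgroup
  Literature.NumberTheory.IwasawaTheory Literature.NumberTheory.GaloisRepresentations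
  Literature.NumberTheory.GaloisRepresentations.Herbrand Literature.NumberTheory.GaloisRepresentations.MinkowskiUnit
  Literature.NumberTheory.GaloisRepresentations.CyclicNormIndex
  Literature.NumberTheory.EllipticCurves Literature.NumberTheory.EllipticCurves.Greenberg1999
  Literature.NumberTheory.EllipticCurves.ModularForms
  Literature.NumberTheory.EllipticCurves.Rank1Residual
  Literature.NumberTheory.EllipticCurves.Module
  Literature.NumberTheory.NumberFields Literature.NumberTheory.NumberFields.AmbiguousClass
  Summit.BirchSwinnertonDyer.Rank1Residual
  Summit.BirchSwinnertonDyer.Rank1Residual.X1.MuLambda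
  Summit.BirchSwinnertonDyer.Rank1Residual.X5
  Summit.BirchSwinnertonDyer.Rank1Residual.F1Sign2
  Summit.BirchSwinnertonDyer.BirchSwinnertonDyer.Theorems.Rank1ResidualX1Defs
  Summit.BirchSwinnertonDyer.BirchSwinnertonDyer.Theses.AlignedTransportAtTwo
  Summit.BirchSwinnertonDyer.BirchSwinnertonDyer.Theorems.AlignedTransportAtTwoKilfordStratumShared
  Summit.BirchSwinnertonDyer.BirchSwinnertonDyer.Theorems.AlignedTransportAtTwoCubicCarrierRoad
  Summit.BirchSwinnertonDyer.BirchSwinnertonDyer.Theorems.AlignedTransportAtTwoCubicKilfordPrimes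
  Summit.BirchSwinnertonDyer.BirchSwinnertonDyer.Theorems.AlignedTransportAtTwoCubicDepthDoorGenusCert
  Summit.BirchSwinnertonDyer.BirchSwinnertonDyer.Theorems.AlignedTransportAtTwoCubicPrimesOfEmbeddings
  Summit.BirchSwinnertonDyer.BirchSwinnertonDyer.Theorems.AlignedTransportAtTwoCubicLayerOneDoors

variable (W : WeierstrassCurve ℚ) [W.IsElliptic] [W.IsGloballyMinimal]

/-! ## §1 `μ₂ = 0`, `λ₂ ≤ 2` for the cubic `2`-torsion field from the genus certificate and the capitulation certificate -/

/-- **THE CAPITULATION DOOR FOR THE CUBIC `2`-TORSION FIELD.**  `W/ℚ` globally minimal, good ordinary at `2`, no rational `2`-torsion abscissa,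
`Δ_min ≡ 5 (mod 8)` (exactly two primes of `ℚ(β)` above `2`), `Δ_W < 0` (unit rank `1`), `β ∈ ℚ̄` a root of the `2`-division cubic; displayed: `h(ℚ(β))` odd,
`2 ∤ d_{ℚ(β)}`, an ideal `𝔭₁` of norm `2`, a unit `ε ≡ ±1 (mod 𝔭₁³)` with `±ε` non-squares of units, att-p3 g43's ODD genus certificate `x² − 2y² = u·α²`,
`mα + nx = 1`, `m'α² + 2n' = 1`, `α ≡ ±3 (mod 𝔭₁³)` (so `ord₂ h(ℚ(β,√2)) = 1` with the class of order two `[𝔔]`, `𝔔 = (x + y√2, α)`), and the CAPITULATION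
certificate `ξ, a, b, c, e ∈ 𝓞_{ℚ(β)}[θ]` (`θ⁴ − 4θ² + 2 = 0`): `x + y(θ² − 2) = ξa`, `α = ξb`, `ξ = c(x + y(θ² − 2)) + eα` at every root of `X⁴ − 4X² + 2` in
every `𝓞_{ℚ(β)}`-algebra (i.e. `𝔔` becomes principal in the layer `K_2 ∋ θ`).  THEN for every cyclotomic `ℤ₂`-extension `κ` of `ℚ(β)`:
`rank₂ Cl(K_m) = rank₂ Cl(K_2)` for all `m ≥ 2`, `μ₂(κ) = 0`, `λ₂(κ) ≤ 2`, `rank₂ Cl(K_2) ≤ 2`. [cite: Gras2003, IV.4] [cite: Greenberg1976, §4]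
[cite: Fukuda1994, Thm. 1 (2), p. 264] [cite: Serre1973CourseArithmetic, Ch. III §1.2, Thm. 1] -/
theorem classicalMuVanishes_adjoin_of_genusCert_odd_of_capitulationCert (hord : IsOrdinaryAt W 2)
    (ht : ∀ x : ℚ, ¬ HasRationalTwoTorsionX W x) (h85 : minimalDiscriminantInt W % 8 = 5) (hΔ : W.Δ < 0)
    {β : AlgebraicClosure ℚ} (hβ : aeval β W.twoTorsionPolynomial.toPoly = 0)
    (hh : haveI : FiniteDimensional ℚ ↥(IntermediateField.adjoin ℚ ({β} : Set (AlgebraicClosure ℚ))) :=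
        IntermediateField.adjoin.finiteDimensional ((AlgebraicClosure.isAlgebraic ℚ).isAlgebraic β).isIntegral
      haveI : NumberField ↥(IntermediateField.adjoin ℚ ({β} : Set (AlgebraicClosure ℚ))) := NumberField.mk
      ¬ 2 ∣ classNumber ↥(IntermediateField.adjoin ℚ ({β} : Set (AlgebraicClosure ℚ))))
    (hd : haveI : FiniteDimensional ℚ ↥(IntermediateField.adjoin ℚ ({β} : Set (AlgebraicClosure ℚ))) :=
        IntermediateField.adjoin.finiteDimensional ((AlgebraicClosure.isAlgebraic ℚ).isAlgebraic β).isIntegral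
      haveI : NumberField ↥(IntermediateField.adjoin ℚ ({β} : Set (AlgebraicClosure ℚ))) := NumberField.mk
      ¬ (2 : ℤ) ∣ NumberField.discr ↥(IntermediateField.adjoin ℚ ({β} : Set (AlgebraicClosure ℚ))))
    (𝔭₁ : Ideal (𝓞 ↥(IntermediateField.adjoin ℚ ({β} : Set (AlgebraicClosure ℚ)))))
    (hN : haveI : FiniteDimensional ℚ ↥(IntermediateField.adjoin ℚ ({β} : Set (AlgebraicClosure ℚ))) :=
        IntermediateField.adjoin.finiteDimensional ((AlgebraicClosure.isAlgebraic ℚ).isAlgebraic β).isIntegral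
      haveI : NumberField ↥(IntermediateField.adjoin ℚ ({β} : Set (AlgebraicClosure ℚ))) := NumberField.mk
      Ideal.absNorm 𝔭₁ = 2)
    {ε : (𝓞 ↥(IntermediateField.adjoin ℚ ({β} : Set (AlgebraicClosure ℚ))))ˣ}
    (hε : (ε : 𝓞 ↥(IntermediateField.adjoin ℚ ({β} : Set (AlgebraicClosure ℚ)))) - 1 ∈ 𝔭₁ ^ 3 ∨ (ε : 𝓞 ↥(IntermediateField.adjoin ℚ ({β} : Set (AlgebraicClosure ℚ)))) + 1 ∈ 𝔭₁ ^ 3)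
    (hnsq : ∀ z : (𝓞 ↥(IntermediateField.adjoin ℚ ({β} : Set (AlgebraicClosure ℚ))))ˣ, ε ≠ z ^ 2 ∧ ε ≠ -z ^ 2)
    {x y α m n m' n' : 𝓞 ↥(IntermediateField.adjoin ℚ ({β} : Set (AlgebraicClosure ℚ)))} {u : (𝓞 ↥(IntermediateField.adjoin ℚ ({β} : Set (AlgebraicClosure ℚ))))ˣ}
    (hxy : x ^ 2 - 2 * y ^ 2 = (u : 𝓞 ↥(IntermediateField.adjoin ℚ ({β} : Set (AlgebraicClosure ℚ)))) * α ^ 2) (hbez : m * α + n * x = 1) (hbez' : m' * α ^ 2 + n' * 2 = 1)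
    (hα : α - 3 ∈ 𝔭₁ ^ 3 ∨ α + 3 ∈ 𝔭₁ ^ 3)
    {ξ₀ ξ₁ ξ₂ ξ₃ a₀ a₁ a₂ a₃ b₀ b₁ b₂ b₃ c₀ c₁ c₂ c₃ e₀ e₁ e₂ e₃ : 𝓞 ↥(IntermediateField.adjoin ℚ ({β} : Set (AlgebraicClosure ℚ)))}
    (hξa : ∀ (S : Type) [CommRing S] [Algebra (𝓞 ↥(IntermediateField.adjoin ℚ ({β} : Set (AlgebraicClosure ℚ)))) S] (ϑ : S), ϑ ^ 4 - 4 * ϑ ^ 2 + 2 = 0 →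
      algebraMap (𝓞 ↥(IntermediateField.adjoin ℚ ({β} : Set (AlgebraicClosure ℚ)))) S x + algebraMap (𝓞 ↥(IntermediateField.adjoin ℚ ({β} : Set (AlgebraicClosure ℚ)))) S y * (ϑ ^ 2 - 2) = (algebraMap (𝓞 ↥(IntermediateField.adjoin ℚ ({β} : Set (AlgebraicClosure ℚ)))) S ξ₀ + algebraMap (𝓞 ↥(IntermediateField.adjoin ℚ ({β} : Set (AlgebraicClosure ℚ)))) S ξ₁ * ϑ + algebraMap (𝓞 ↥(IntermediateField.adjoin ℚ ({β} : Set (AlgebraicClosure ℚ)))) S ξ₂ * ϑ ^ 2 + algebraMap (𝓞 ↥(IntermediateField.adjoin ℚ ({β} : Set (AlgebraicClosure ℚ)))) S ξ₃ * ϑ ^ 3) * (algebraMap (𝓞 ↥(IntermediateField.adjoin ℚ ({β} : Set (AlgebraicClosure ℚ)))) S a₀ + algebraMap (𝓞 ↥(IntermediateField.adjoin ℚ ({β} : Set (AlgebraicClosure ℚ)))) S a₁ * ϑ + algebraMap (𝓞 ↥(IntermediateField.adjoin ℚ ({β} : Set (AlgebraicClosure ℚ)))) S a₂ * ϑ ^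 2 + algebraMap (𝓞 ↥(IntermediateField.adjoin ℚ ({β} : Set (AlgebraicClosure ℚ)))) S a₃ * ϑ ^ 3))
    (hξb : ∀ (S : Type) [CommRing S] [Algebra (𝓞 ↥(IntermediateField.adjoin ℚ ({β} : Set (AlgebraicClosure ℚ)))) S] (ϑ : S), ϑ ^ 4 - 4 * ϑ ^ 2 + 2 = 0 →
      algebraMap (𝓞 ↥(IntermediateField.adjoin ℚ ({β} : Set (AlgebraicClosure ℚ)))) S α = (algebraMap (𝓞 ↥(IntermediateField.adjoin ℚ ({β} : Set (AlgebraicClosure ℚ)))) S ξ₀ + algebraMap (𝓞 ↥(IntermediateField.adjoin ℚ ({β} : Set (AlgebraicClosure ℚ)))) S ξ₁ * ϑ + algebraMap (𝓞 ↥(IntermediateField.adjoin ℚ ({β} : Set (AlgebraicClosure ℚ)))) S ξ₂ * ϑ ^ 2 + algebraMap (𝓞 ↥(IntermediateField.adjoin ℚ ({β} : Set (AlgebraicClosure ℚ)))) S ξ₃ * ϑ ^ 3) * (algebraMap (𝓞 ↥(IntermediateField.adjoin ℚ ({β} : Set (AlgebraicClosure ℚ)))) S b₀ + algebraMap (𝓞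 ↥(IntermediateField.adjoin ℚ ({β} : Set (AlgebraicClosure ℚ)))) S b₁ * ϑ + algebraMap (𝓞 ↥(IntermediateField.adjoin ℚ ({β} : Set (AlgebraicClosure ℚ)))) S b₂ * ϑ ^ 2 + algebraMap (𝓞 ↥(IntermediateField.adjoin ℚ ({β} : Set (AlgebraicClosure ℚ)))) S b₃ * ϑ ^ 3))
    (hξc : ∀ (S : Type) [CommRing S] [Algebra (𝓞 ↥(IntermediateField.adjoin ℚ ({β} : Set (AlgebraicClosure ℚ)))) S] (ϑ : S), ϑ ^ 4 - 4 * ϑ ^ 2 + 2 = 0 →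
      algebraMap (𝓞 ↥(IntermediateField.adjoin ℚ ({β} : Set (AlgebraicClosure ℚ)))) S ξ₀ + algebraMap (𝓞 ↥(IntermediateField.adjoin ℚ ({β} : Set (AlgebraicClosure ℚ)))) S ξ₁ * ϑ + algebraMap (𝓞 ↥(IntermediateField.adjoin ℚ ({β} : Set (AlgebraicClosure ℚ)))) S ξ₂ * ϑ ^ 2 + algebraMap (𝓞 ↥(IntermediateField.adjoin ℚ ({β} : Set (AlgebraicClosure ℚ)))) S ξ₃ * ϑ ^ 3 =
        (algebraMap (𝓞 ↥(IntermediateField.adjoin ℚ ({β} : Set (AlgebraicClosure ℚ)))) S c₀ + algebraMap (𝓞 ↥(IntermediateField.adjoin ℚ ({β} : Set (AlgebraicClosure ℚ)))) S c₁ * ϑ + algebraMap (𝓞 ↥(IntermediateField.adjoin ℚ ({β} : Set (AlgebraicClosure ℚ)))) S c₂ * ϑ ^ 2 + algebraMap (𝓞 ↥(IntermediateField.adjoin ℚ ({β} : Set (AlgebraicClosure ℚ)))) S c₃ * ϑ ^ 3) * (algebraMap (𝓞 ↥(IntermediateField.adjoin ℚ ({β} : Set (AlgebraicClosure ℚ))))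 S x + algebraMap (𝓞 ↥(IntermediateField.adjoin ℚ ({β} : Set (AlgebraicClosure ℚ)))) S y * (ϑ ^ 2 - 2)) + (algebraMap (𝓞 ↥(IntermediateField.adjoin ℚ ({β} : Set (AlgebraicClosure ℚ)))) S e₀ + algebraMap (𝓞 ↥(IntermediateField.adjoin ℚ ({β} : Set (AlgebraicClosure ℚ)))) S e₁ * ϑ + algebraMap (𝓞 ↥(IntermediateField.adjoin ℚ ({β} : Set (AlgebraicClosure ℚ)))) S e₂ * ϑ ^ 2 + algebraMap (𝓞 ↥(IntermediateField.adjoin ℚ ({β} : Set (AlgebraicClosure ℚ)))) S e₃ * ϑ ^ 3) * algebraMap (𝓞 ↥(IntermediateField.adjoin ℚ ({β} : Set (AlgebraicClosure ℚ)))) S α)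
    (κP : ZpExtension ↥(IntermediateField.adjoin ℚ ({β} : Set (AlgebraicClosure ℚ))) 2) (hκP : κP.IsCyclotomic) :
    (∀ m, 2 ≤ m → classGroupPRank κP m = classGroupPRank κP 2) ∧ ClassicalMuVanishes κP ∧ classicalLambda κP ≤ 2 ∧
      classGroupPRank κP 2 ≤ 2 := by
  have hirr := AlignedTransportAtTwoSeed.irr_two_of_forall_not_hasRationalTwoTorsionX W ht
  have hβint : IsIntegral ℚ β := ((AlgebraicClosure.isAlgebraic ℚ).isAlgebraic β).isIntegral
  haveI : FiniteDimensional ℚ ↥(IntermediateField.adjoin ℚ ({β} : Set (AlgebraicClosure ℚ))) := IntermediateField.adjoin.finiteDimensional hβint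
  haveI : NumberField ↥(IntermediateField.adjoin ℚ ({β} : Set (AlgebraicClosure ℚ))) := NumberField.mk
  haveI : Fact (Nat.Prime 2) := ⟨Nat.prime_two⟩
  haveI : FiniteDimensional ↥(IntermediateField.adjoin ℚ ({β} : Set (AlgebraicClosure ℚ))) (κP.layer 1) := κP.finiteDimensional_layer_holds 1
  haveI : NumberField (κP.layer 1) := NumberField.of_module_finite ↥(IntermediateField.adjoin ℚ ({β} : Set (AlgebraicClosure ℚ))) _
  haveI : FiniteDimensional ↥(IntermediateField.adjoin ℚ ({β} : Set (AlgebraicClosure ℚ))) (κP.layer 2) := κP.finiteDimensional_layer_holds 2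
  haveI : NumberField (κP.layer 2) := NumberField.of_module_finite ↥(IntermediateField.adjoin ℚ ({β} : Set (AlgebraicClosure ℚ))) _
  have h3 : Module.finrank ℚ ↥(IntermediateField.adjoin ℚ ({β} : Set (AlgebraicClosure ℚ))) = 3 := AddKatoTwo.finrank_adjoin_root_twoTorsionPolynomial_eq_three W hirr hβ
  have hodd3 : ¬ 2 ∣ Module.finrank ℚ ↥(IntermediateField.adjoin ℚ ({β} : Set (AlgebraicClosure ℚ))) := by rw [h3]; decide
  have hoddK : Odd (Module.finrank ℚ ↥(IntermediateField.adjoin ℚ ({β} : Set (AlgebraicClosure ℚ)))) := Nat.odd_iff.mpr (by rw [h3])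
  have hodd : Odd (classNumber ↥(IntermediateField.adjoin ℚ ({β} : Set (AlgebraicClosure ℚ)))) := Nat.odd_iff.mpr (Nat.two_dvd_ne_zero.mp hh)
  have hrank : Units.rank ↥(IntermediateField.adjoin ℚ ({β} : Set (AlgebraicClosure ℚ))) = 1 :=
    units_rank_eq_one_of_nrRealPlaces_eq_one _ h3 (nrRealPlaces_adjoin_root_twoTorsionPolynomial_eq_one W hΔ hirr hβ)
  have h8 : minimalDiscriminantInt W % 8 ≠ 1 := by rw [h85]; decide
  have hs := (not_onKilfordStratumAtTwo_iff_minimalDiscriminantInt_emod_eight_ne W hord).mpr h8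
  have h2 := ncard_eq_two_of_not_onKilfordStratumAtTwo ↥(IntermediateField.adjoin ℚ ({β} : Set (AlgebraicClosure ℚ))) W hord ht h3
    (AlignedTransportAtTwoCubicKilfordPrimes.aeval_four_mul_gen_twoDivisionUCubic W hβ) hs
  -- every unit is `≡ ±1 (mod 𝔭₁³)`
  obtain ⟨h𝔭₁, hP0, h2P, hcard⟩ := isPrime_and_mem_of_absNorm_eq_two 𝔭₁ hN
  haveI := h𝔭₁
  haveI : 𝔭₁.IsMaximal := h𝔭₁.isMaximal hP0
  have hres := forall_mem_or_sub_one_mem_of_card_quotient_eq_two 𝔭₁ hcard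
  have h2P' : (2 : 𝓞 ↥(IntermediateField.adjoin ℚ ({β} : Set (AlgebraicClosure ℚ)))) ∉ 𝔭₁ ^ 2 := two_not_mem_sq_of_not_dvd_discr hd 𝔭₁ h2P
  have hunits := forall_units_sub_one_mem_or_add_one_mem_of_rank_eq_one hoddK hrank 𝔭₁ hP0 hres h2P h2P' hε hnsq
  exact classicalMuVanishes_two_of_genusCert_odd_of_capitulationCert κP hodd3 hd hodd hκP h2.le 𝔭₁ hN hunits hxy hbez hbez' hα hξa hξb hξc

/-! ## §2 The door into `MC₂(W)` -/

/-- **THE CAPITULATION DOOR INTO `MC₂(W)`.**  PRINT⁵ {Kato 17.4 (1)(2) at `2` (`h17`), Greenberg 4.1 (`hGr`), period unit (`hper`), modularity (`hmod`), GZK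
(`hGZK`)} + MuIneqʳ (`hI`, the registered stub VERBATIM) + the cell hypotheses (good ordinary at `2`, no rational `2`-torsion abscissa, `Δ_W < 0`, `r_an = 0`,
analytic `μ₂ = 0` on the even branch, `BSD₂(W)`) + `Δ_min ≡ 5 (mod 8)` + `β` a root of the `2`-division cubic + the displayed data of `ℚ(β)` (as in §1)
⟹ `MC₂(W)` (att-p5 g24's cubic carrier road ∘ §1). [cite: Kato2004Asterisque, Thm. 17.4 (1)(2) (p. 273)] [cite: GreenbergLNM1716, Thm. 4.1 (p. 102) and Conj. 1.11 (p. 58)]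
[cite: Iwasawa1973MuInvariants, Thm. 2 and Thm. 3] [cite: Gras2003, IV.4] [cite: Greenberg1976, §4] -/
theorem mazurMainConjecture_two_of_muIneqRel_of_genusCert_odd_of_capitulationCert
    (h17 : ∀ [NeZero (W.conductorNorm ℤ)] (f : CuspForm (Gamma0 (W.conductorNorm ℤ)) 2),
      kato_divisibility_allPrimes W 2 (f := f))
    (hGr : Greenberg1999.thm41_charValue_rankZero_anyPrime)
    (hper : realPeriodRat_eq_unit_mul_plusPeriod_two) (hmod : nonempty_modularParametrizationData)
    (hGZK : rank_eq_analyticRank_of_analyticRank_le_one)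
    (hI : ∀ (W : WeierstrassCurve ℚ) [W.IsElliptic] [W.IsGloballyMinimal], IsOrdinaryAt W 2 →
      (∀ x : ℚ, ¬ HasRationalTwoTorsionX W x) →
      ∀ (κ : ZpExtension ℚ 2) (γ : Field.absoluteGaloisGroup ℚ), κ.IsCyclotomic →
      κ.IsTopGenerator γ → IsCyclotomicVariable 2 γ →
      ∀ ⦃N : ℕ⦄ [NeZero N] (f : CuspForm (Gamma0 N) 2), IsNewformOf W f →
      ∀ Gp : IwasawaAlgebra 2, iwasawaToPowerSeries 2 Gp = padicLFunction f (unitRoot W 2 : ℚ_[2]) →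
      ∀ (D : W.SelmerDualData κ γ) (Yr : W.FineSelmerDualDataRelaxedInf κ γ),
        lengthAt (IwasawaAlgebra 2) D.X ⟨IwasawaAlgebra.augIdealP 2, IwasawaAlgebra.isPrime_augIdealP_holds 2⟩ ≤
          lengthAt (IwasawaAlgebra 2) (IwasawaAlgebra 2 ⧸ Ideal.span {Gp})
              ⟨IwasawaAlgebra.augIdealP 2, IwasawaAlgebra.isPrime_augIdealP_holds 2⟩ +
            lengthAt (IwasawaAlgebra 2) Yr.X ⟨IwasawaAlgebra.augIdealP 2, IwasawaAlgebra.isPrime_augIdealP_holds 2⟩)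
    (hord : IsOrdinaryAt W 2) (ht : ∀ x : ℚ, ¬ HasRationalTwoTorsionX W x) (hΔ : W.Δ < 0) (hr : W.analyticRank = 0)
    (hμan : ∀ ⦃N : ℕ⦄ [NeZero N] (f : CuspForm (Gamma0 N) 2), IsNewformOf W f →
      ∀ G : IwasawaAlgebra 2, IsEvenBranchLiftAtTwo W f G → red G ≠ 0)
    (hbsd : BSDp W 2) (h85 : minimalDiscriminantInt W % 8 = 5)
    {β : AlgebraicClosure ℚ} (hβ : aeval β W.twoTorsionPolynomial.toPoly = 0)
    (hh : haveI : FiniteDimensional ℚ ↥(IntermediateField.adjoin ℚ ({β} : Set (AlgebraicClosure ℚ))) :=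
        IntermediateField.adjoin.finiteDimensional ((AlgebraicClosure.isAlgebraic ℚ).isAlgebraic β).isIntegral
      haveI : NumberField ↥(IntermediateField.adjoin ℚ ({β} : Set (AlgebraicClosure ℚ))) := NumberField.mk
      ¬ 2 ∣ classNumber ↥(IntermediateField.adjoin ℚ ({β} : Set (AlgebraicClosure ℚ))))
    (hd : haveI : FiniteDimensional ℚ ↥(IntermediateField.adjoin ℚ ({β} : Set (AlgebraicClosure ℚ))) :=
        IntermediateField.adjoin.finiteDimensional ((AlgebraicClosure.isAlgebraic ℚ).isAlgebraic β).isIntegral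
      haveI : NumberField ↥(IntermediateField.adjoin ℚ ({β} : Set (AlgebraicClosure ℚ))) := NumberField.mk
      ¬ (2 : ℤ) ∣ NumberField.discr ↥(IntermediateField.adjoin ℚ ({β} : Set (AlgebraicClosure ℚ))))
    (𝔭₁ : Ideal (𝓞 ↥(IntermediateField.adjoin ℚ ({β} : Set (AlgebraicClosure ℚ)))))
    (hN : haveI : FiniteDimensional ℚ ↥(IntermediateField.adjoin ℚ ({β} : Set (AlgebraicClosure ℚ))) :=
        IntermediateField.adjoin.finiteDimensional ((AlgebraicClosure.isAlgebraic ℚ).isAlgebraic β).isIntegral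
      haveI : NumberField ↥(IntermediateField.adjoin ℚ ({β} : Set (AlgebraicClosure ℚ))) := NumberField.mk
      Ideal.absNorm 𝔭₁ = 2)
    {ε : (𝓞 ↥(IntermediateField.adjoin ℚ ({β} : Set (AlgebraicClosure ℚ))))ˣ}
    (hε : (ε : 𝓞 ↥(IntermediateField.adjoin ℚ ({β} : Set (AlgebraicClosure ℚ)))) - 1 ∈ 𝔭₁ ^ 3 ∨ (ε : 𝓞 ↥(IntermediateField.adjoin ℚ ({β} : Set (AlgebraicClosure ℚ)))) + 1 ∈ 𝔭₁ ^ 3)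
    (hnsq : ∀ z : (𝓞 ↥(IntermediateField.adjoin ℚ ({β} : Set (AlgebraicClosure ℚ))))ˣ, ε ≠ z ^ 2 ∧ ε ≠ -z ^ 2)
    {x y α m n m' n' : 𝓞 ↥(IntermediateField.adjoin ℚ ({β} : Set (AlgebraicClosure ℚ)))} {u : (𝓞 ↥(IntermediateField.adjoin ℚ ({β} : Set (AlgebraicClosure ℚ))))ˣ}
    (hxy : x ^ 2 - 2 * y ^ 2 = (u : 𝓞 ↥(IntermediateField.adjoin ℚ ({β} : Set (AlgebraicClosure ℚ)))) * α ^ 2) (hbez : m * α + n * x = 1) (hbez' : m' * α ^ 2 + n' * 2 = 1)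
    (hα : α - 3 ∈ 𝔭₁ ^ 3 ∨ α + 3 ∈ 𝔭₁ ^ 3)
    {ξ₀ ξ₁ ξ₂ ξ₃ a₀ a₁ a₂ a₃ b₀ b₁ b₂ b₃ c₀ c₁ c₂ c₃ e₀ e₁ e₂ e₃ : 𝓞 ↥(IntermediateField.adjoin ℚ ({β} : Set (AlgebraicClosure ℚ)))}
    (hξa : ∀ (S : Type) [CommRing S] [Algebra (𝓞 ↥(IntermediateField.adjoin ℚ ({β} : Set (AlgebraicClosure ℚ)))) S] (ϑ : S), ϑ ^ 4 - 4 * ϑ ^ 2 + 2 = 0 →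
      algebraMap (𝓞 ↥(IntermediateField.adjoin ℚ ({β} : Set (AlgebraicClosure ℚ)))) S x + algebraMap (𝓞 ↥(IntermediateField.adjoin ℚ ({β} : Set (AlgebraicClosure ℚ)))) S y * (ϑ ^ 2 - 2) = (algebraMap (𝓞 ↥(IntermediateField.adjoin ℚ ({β} : Set (AlgebraicClosure ℚ)))) S ξ₀ + algebraMap (𝓞 ↥(IntermediateField.adjoin ℚ ({β} : Set (AlgebraicClosure ℚ)))) S ξ₁ * ϑ + algebraMap (𝓞 ↥(IntermediateField.adjoin ℚ ({β} : Set (AlgebraicClosure ℚ)))) S ξ₂ * ϑ ^ 2 + algebraMap (𝓞 ↥(IntermediateField.adjoin ℚ ({β} : Set (AlgebraicClosure ℚ)))) S ξ₃ * ϑ ^ 3) * (algebraMap (𝓞 ↥(IntermediateField.adjoin ℚ ({β} : Set (AlgebraicClosure ℚ)))) S a₀ + algebraMap (𝓞 ↥(IntermediateField.adjoin ℚ ({β} : Set (AlgebraicClosure ℚ)))) S a₁ * ϑ + algebraMap (𝓞 ↥(IntermediateField.adjoin ℚ ({β} : Set (AlgebraicClosure ℚ)))) S a₂ * ϑ ^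 2 + algebraMap (𝓞 ↥(IntermediateField.adjoin ℚ ({β} : Set (AlgebraicClosure ℚ)))) S a₃ * ϑ ^ 3))
    (hξb : ∀ (S : Type) [CommRing S] [Algebra (𝓞 ↥(IntermediateField.adjoin ℚ ({β} : Set (AlgebraicClosure ℚ)))) S] (ϑ : S), ϑ ^ 4 - 4 * ϑ ^ 2 + 2 = 0 →
      algebraMap (𝓞 ↥(IntermediateField.adjoin ℚ ({β} : Set (AlgebraicClosure ℚ)))) S α = (algebraMap (𝓞 ↥(IntermediateField.adjoin ℚ ({β} : Set (AlgebraicClosure ℚ)))) S ξ₀ + algebraMap (𝓞 ↥(IntermediateField.adjoin ℚ ({β} : Set (AlgebraicClosure ℚ)))) S ξ₁ * ϑ + algebraMap (𝓞 ↥(IntermediateField.adjoin ℚ ({β} : Set (AlgebraicClosure ℚ)))) S ξ₂ * ϑ ^ 2 + algebraMap (𝓞 ↥(IntermediateField.adjoin ℚ ({β} : Set (AlgebraicClosure ℚ)))) S ξ₃ * ϑ ^ 3) * (algebraMap (𝓞 ↥(IntermediateField.adjoin ℚ ({β} : Set (AlgebraicClosure ℚ)))) S b₀ + algebraMap (𝓞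 ↥(IntermediateField.adjoin ℚ ({β} : Set (AlgebraicClosure ℚ)))) S b₁ * ϑ + algebraMap (𝓞 ↥(IntermediateField.adjoin ℚ ({β} : Set (AlgebraicClosure ℚ)))) S b₂ * ϑ ^ 2 + algebraMap (𝓞 ↥(IntermediateField.adjoin ℚ ({β} : Set (AlgebraicClosure ℚ)))) S b₃ * ϑ ^ 3))
    (hξc : ∀ (S : Type) [CommRing S] [Algebra (𝓞 ↥(IntermediateField.adjoin ℚ ({β} : Set (AlgebraicClosure ℚ)))) S] (ϑ : S), ϑ ^ 4 - 4 * ϑ ^ 2 + 2 = 0 →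
      algebraMap (𝓞 ↥(IntermediateField.adjoin ℚ ({β} : Set (AlgebraicClosure ℚ)))) S ξ₀ + algebraMap (𝓞 ↥(IntermediateField.adjoin ℚ ({β} : Set (AlgebraicClosure ℚ)))) S ξ₁ * ϑ + algebraMap (𝓞 ↥(IntermediateField.adjoin ℚ ({β} : Set (AlgebraicClosure ℚ)))) S ξ₂ * ϑ ^ 2 + algebraMap (𝓞 ↥(IntermediateField.adjoin ℚ ({β} : Set (AlgebraicClosure ℚ)))) S ξ₃ * ϑ ^ 3 =
        (algebraMap (𝓞 ↥(IntermediateField.adjoin ℚ ({β} : Set (AlgebraicClosure ℚ)))) S c₀ + algebraMap (𝓞 ↥(IntermediateField.adjoin ℚ ({β} : Set (AlgebraicClosure ℚ)))) S c₁ * ϑ + algebraMap (𝓞 ↥(IntermediateField.adjoin ℚ ({β} : Set (AlgebraicClosure ℚ)))) S c₂ * ϑ ^ 2 + algebraMap (𝓞 ↥(IntermediateField.adjoin ℚ ({β} : Set (AlgebraicClosure ℚ)))) S c₃ * ϑ ^ 3) * (algebraMap (𝓞 ↥(IntermediateField.adjoin ℚ ({β} : Set (AlgebraicClosure ℚ))))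 S x + algebraMap (𝓞 ↥(IntermediateField.adjoin ℚ ({β} : Set (AlgebraicClosure ℚ)))) S y * (ϑ ^ 2 - 2)) + (algebraMap (𝓞 ↥(IntermediateField.adjoin ℚ ({β} : Set (AlgebraicClosure ℚ)))) S e₀ + algebraMap (𝓞 ↥(IntermediateField.adjoin ℚ ({β} : Set (AlgebraicClosure ℚ)))) S e₁ * ϑ + algebraMap (𝓞 ↥(IntermediateField.adjoin ℚ ({β} : Set (AlgebraicClosure ℚ)))) S e₂ * ϑ ^ 2 + algebraMap (𝓞 ↥(IntermediateField.adjoin ℚ ({β} : Set (AlgebraicClosure ℚ)))) S e₃ * ϑ ^ 3) * algebraMap (𝓞 ↥(IntermediateField.adjoin ℚ ({β} : Set (AlgebraicClosure ℚ)))) S α) :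
    MazurMainConjecture W 2 :=
  mazurMainConjecture_two_of_muIneqRel_of_classicalMu_cubicField_of_Δ_neg W h17 hGr hper hmod hGZK hI hord ht hΔ hr hμan hbsd hβ
    fun κP hκP => (classicalMuVanishes_adjoin_of_genusCert_odd_of_capitulationCert W hord ht h85 hΔ hβ hh hd 𝔭₁ hN hε hnsq hxy hbez hbez' hα
      hξa hξb hξc κP hκP).2.1

end Summit.BirchSwinnertonDyer.BirchSwinnertonDyer.Theorems.AlignedTransportAtTwoCubicCapitulationDoor

end
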